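import Literature.AlgebraicGeometry.Resolution.ValuationRingsApproximation
import Mathlib.RingTheory.Norm.Transitivity
import Mathlib.FieldTheory.Galois.Basic
import HarnessLib

/-!
# Conjugacy of the extensions of a valuation ring to a finite Galois extension

Topic: `Literature/AlgebraicGeometry/Resolution` (valuation theory; second file of the proof of
the named fact `KuhlmannNovacoski2014_Thm12`, after `ValuationRingsApproximation.lean`).

* `ValuationSubring.exists_smul_eq_of_comap_eq` — **the conjugation theorem** (Endler,
  *Valuation theory*, (14.1); Engler–Prestel, *Valued fields*, Thm. 3.2.15; Zariski–Samuel II,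
  VI §7 Thm. 12 Cor. 3): for a finite Galois extension `E|F`, two valuation rings `W, W'` of
  `E` with `W ∩ F = W' ∩ F` are conjugate, `W' = σ(W)` for some `σ ∈ Gal(E|F)`.

Proof (Zariski–Samuel's): if the `Gal(E|F)`-orbits of `W` and `W'` were disjoint, their union
would be a finite family of valuation rings lying over `W ∩ F`, pairwise incomparable
(`ValuationSubring.eq_of_le_of_comap_eq`), so weak approximation
(`ValuationSubring.exists_crt_of_forall_le_imp_eq`) gives `x` in all of them which is a
non-unit of every conjugate of `W` and `≡ 1` modulo the maximal ideal of every conjugate of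
`W'`; then the norm `N(x) = ∏_σ σ(x) ∈ F` is a non-unit of `W` and a unit of `W'`, while
`W ∩ F = W' ∩ F` — contradiction.

All statements [folklore]; nothing is defined.
-/

noncomputable section

open scoped Pointwise
open Finset

namespace Literature.AlgebraicGeometry.Resolution

namespace ValuationSubring

variable {F E : Type*} [Field F] [Field E] [Algebra F E]

/-! ## The Galois action on valuation rings -/

/-- `y ∈ σ(W) ↔ σ⁻¹(y) ∈ W`. [folklore] -/
theorem mem_smul_iff (σ : E ≃ₐ[F] E) (W : _root_.ValuationSubring E) (y : E) :
    y ∈ σ • W ↔ σ.symm y ∈ W :=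
  _root_.ValuationSubring.mem_pointwise_smul_iff_inv_smul_mem

/-- The value of `y` at `σ(W)` is `< 1` iff the value of `σ⁻¹(y)` at `W` is. [folklore] -/
theorem valuation_smul_lt_one_iff (σ : E ≃ₐ[F] E) (W : _root_.ValuationSubring E) (y : E) :
    (σ • W).valuation y < 1 ↔ W.valuation (σ.symm y) < 1 := by
  rw [← _root_.ValuationSubring.mem_nonunits_iff, ← _root_.ValuationSubring.mem_nonunits_iff,
    _root_.ValuationSubring.mem_nonunits_iff_or, _root_.ValuationSubring.mem_nonunits_iff_or,
    mem_smul_iff, map_inv₀, map_eq_zero_iff _ σ.symm.injective]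

/-- The value of `y` at `σ(W)` is `≤ 1` iff the value of `σ⁻¹(y)` at `W` is. [folklore] -/
theorem valuation_smul_le_one_iff (σ : E ≃ₐ[F] E) (W : _root_.ValuationSubring E) (y : E) :
    (σ • W).valuation y ≤ 1 ↔ W.valuation (σ.symm y) ≤ 1 := by
  rw [_root_.ValuationSubring.valuation_le_one_iff, _root_.ValuationSubring.valuation_le_one_iff,
    mem_smul_iff]

/-- The value of `y` at `σ(W)` is `1` iff the value of `σ⁻¹(y)` at `W` is. [folklore] -/
theorem valuation_smul_eq_one_iff (σ : E ≃ₐ[F] E) (W : _root_.ValuationSubring E) (y : E) :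
    (σ • W).valuation y = 1 ↔ W.valuation (σ.symm y) = 1 := by
  constructor
  · intro h
    refine le_antisymm ((valuation_smul_le_one_iff σ W y).mp h.le) ?_
    by_contra hlt
    rw [not_le, ← valuation_smul_lt_one_iff] at hlt
    exact hlt.ne h
  · intro h
    refine le_antisymm ((valuation_smul_le_one_iff σ W y).mpr h.le) ?_
    by_contra hlt
    rw [not_le, valuation_smul_lt_one_iff] at hlt
    exact hlt.ne h

/-- Conjugate valuation rings lie over the same valuation ring of `F`. [folklore] -/
theorem comap_smul (σ : E ≃ₐ[F] E) (W : _root_.ValuationSubring E) :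
    (σ • W).comap (algebraMap F E) = W.comap (algebraMap F E) := by
  ext b
  rw [_root_.ValuationSubring.mem_comap, _root_.ValuationSubring.mem_comap, mem_smul_iff,
    AlgEquiv.commutes]

/-! ## Restriction to `F` of units and non-units -/

/-- If `b ∈ F` is a non-unit of `W`, it is a non-unit of `W ∩ F`. [folklore] -/
theorem valuation_comap_lt_one (W : _root_.ValuationSubring E) {b : F}
    (hb : W.valuation (algebraMap F E b) < 1) : (W.comap (algebraMap F E)).valuation b < 1 := by
  have hbO : b ∈ W.comap (algebraMap F E) := (W.valuation_le_one_iff _).mp hb.le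
  refine lt_of_le_of_ne (((W.comap _).valuation_le_one_iff b).mpr hbO) fun h1 => ?_
  exact hb.ne (valuation_algebraMap_eq_one W h1)

/-- If `b ∈ F` is a unit of `W`, it is a unit of `W ∩ F`. [folklore] -/
theorem valuation_comap_eq_one (W : _root_.ValuationSubring E) {b : F}
    (hb : W.valuation (algebraMap F E b) = 1) : (W.comap (algebraMap F E)).valuation b = 1 := by
  have hbO : b ∈ W.comap (algebraMap F E) := (W.valuation_le_one_iff _).mp hb.le
  refine le_antisymm (((W.comap _).valuation_le_one_iff b).mpr hbO) ?_
  by_contra hlt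
  rw [not_le] at hlt
  exact (valuation_algebraMap_lt_one W hlt).ne hb

/-! ## The conjugation theorem -/

/-- **Conjugation theorem** (Endler (14.1); Engler–Prestel Thm. 3.2.15; Zariski–Samuel II, VI §7):
in a finite Galois extension `E|F`, valuation rings of `E` lying over the same valuation ring
of `F` are conjugate under `Gal(E|F)`. [folklore] -/
theorem exists_smul_eq_of_comap_eq [FiniteDimensional F E] [IsGalois F E]
    (W W' : _root_.ValuationSubring E)
    (hO : W.comap (algebraMap F E) = W'.comap (algebraMap F E)) :
    ∃ σ : E ≃ₐ[F] E, σ • W = W' := by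
  classical
  haveI : Algebra.IsAlgebraic F E := Algebra.IsAlgebraic.of_finite F E
  by_contra hcon
  push Not at hcon
  -- the two (disjoint) orbits and their union
  set S₁ : Finset (_root_.ValuationSubring E) :=
    Finset.univ.image fun σ : E ≃ₐ[F] E => σ • W with hS₁
  set S₂ : Finset (_root_.ValuationSubring E) :=
    Finset.univ.image fun σ : E ≃ₐ[F] E => σ • W' with hS₂
  set S : Finset (_root_.ValuationSubring E) := S₁ ∪ S₂ with hS
  have hdisj : ∀ R ∈ S₁, R ∉ S₂ := by
    intro R hR hR'
    obtain ⟨σ, -, rfl⟩ := Finset.mem_image.mp hR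
    obtain ⟨τ, -, hτ⟩ := Finset.mem_image.mp hR'
    apply hcon (τ⁻¹ * σ)
    rw [mul_smul, ← hτ, inv_smul_smul]
  have hW : W ∈ S₁ := Finset.mem_image.mpr ⟨1, Finset.mem_univ _, one_smul _ _⟩
  have hW' : W' ∈ S₂ := Finset.mem_image.mpr ⟨1, Finset.mem_univ _, one_smul _ _⟩
  -- every member of `S` lies over `O = W ∩ F`
  have hover : ∀ R ∈ S, R.comap (algebraMap F E) = W.comap (algebraMap F E) := by
    intro R hR
    rcases Finset.mem_union.mp hR with hR | hR
    · obtain ⟨σ, -, rfl⟩ := Finset.mem_image.mp hR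
      exact comap_smul σ W
    · obtain ⟨σ, -, rfl⟩ := Finset.mem_image.mp hR
      rw [comap_smul σ W', hO]
  -- the family indexed by `S` is pairwise incomparable
  have hinc : ∀ i j : S, (i : _root_.ValuationSubring E) ≤ j → i = j := by
    intro i j hij
    by_contra hne
    have hne' : (i : _root_.ValuationSubring E) ≠ j := fun h => hne (Subtype.ext h)
    exact not_le_of_ne_of_comap_eq hne' ((hover i i.2).trans (hover j j.2).symm) hij
  -- weak approximation: `e j ≡ 1` at `j`, `≡ 0` at every other member of `S`
  have hcrt := fun j : S =>
    exists_crt_of_forall_le_imp_eq (fun i : S => (i : _root_.ValuationSubring E)) hinc j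
  choose e hemem heone helt using hcrt
  -- `x := ∑_{j ∈ orbit of W'} e j`
  set J : Finset S := Finset.univ.filter fun j : S => (j : _root_.ValuationSubring E) ∈ S₂ with hJ
  set x : E := ∑ j ∈ J, e j with hx
  have hxmem : ∀ R ∈ S, x ∈ R := fun R hR =>
    sum_mem fun j _ => hemem j ⟨R, hR⟩
  have hx1 : ∀ R (hR : R ∈ S₂), R.valuation (x - 1) < 1 := by
    intro R hR
    have hRS : R ∈ S := Finset.mem_union_right _ hR
    set j₀ : S := ⟨R, hRS⟩
    have hj₀ : j₀ ∈ J := Finset.mem_filter.mpr ⟨Finset.mem_univ _, hR⟩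
    have : x - 1 = (e j₀ - 1) + ∑ j ∈ J.erase j₀, e j := by
      rw [hx, ← Finset.add_sum_erase _ _ hj₀]
      ring
    rw [this]
    refine R.valuation.map_add_lt (heone j₀) (R.valuation.map_sum_lt one_ne_zero fun j hj => ?_)
    exact helt j j₀ (Finset.ne_of_mem_erase hj).symm
  have hx0 : ∀ R (hR : R ∈ S₁), R.valuation x < 1 := by
    intro R hR
    have hRS : R ∈ S := Finset.mem_union_left _ hR
    refine R.valuation.map_sum_lt one_ne_zero fun j hj => helt j ⟨R, hRS⟩ fun h => ?_
    have hj2 : (j : _root_.ValuationSubring E) ∈ S₂ := (Finset.mem_filter.mp hj).2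
    rw [← h] at hj2
    exact hdisj R hR hj2
  -- the norm of `x`
  set n : F := Algebra.norm F x with hn
  have hnorm : algebraMap F E n = ∏ σ : E ≃ₐ[F] E, σ x := Algebra.norm_eq_prod_automorphisms F x
  -- a non-unit of `W`
  have hnW : W.valuation (algebraMap F E n) < 1 := by
    rw [hnorm]
    refine valuation_prod_lt_one W _ _ (fun σ _ => ?_) (Finset.mem_univ 1) ?_
    · rw [W.valuation_le_one_iff, ← σ.symm_symm, ← mem_smul_iff]
      exact hxmem _ (Finset.mem_union_left _
        (Finset.mem_image.mpr ⟨σ.symm, Finset.mem_univ _, rfl⟩))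
    · rw [AlgEquiv.one_apply]
      exact hx0 W hW
  -- a unit of `W'`
  have hnW' : W'.valuation (algebraMap F E n) = 1 := by
    rw [hnorm]
    refine valuation_prod_eq_one W' _ _ fun σ _ => ?_
    rw [← σ.symm_symm, ← valuation_smul_eq_one_iff]
    exact valuation_eq_one_of_sub_one _
      (hx1 _ (Finset.mem_image.mpr ⟨σ.symm, Finset.mem_univ _, rfl⟩))
  -- contradiction in `O = W ∩ F = W' ∩ F`
  have h1 := valuation_comap_lt_one W hnW
  have h2 := valuation_comap_eq_one W' hnW'
  rw [hO] at h1
  exact h1.ne h2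

end ValuationSubring

end Literature.AlgebraicGeometry.Resolution

end
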